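import Summits.HodgeConjecture.CorCM.PairFlipSexticFourCoreCodimTwo
import Summits.HodgeConjecture.CorCM.SexticCMFieldPairFlip
import HarnessLib

/-!
# COR-CM — the frame of a PAIR-FLIP sextic CM field: `Hom(K, ℂ) ≃ ℤ/3 × Bool` in which every map of
# `(ℤ/2)³ ⋊ C₃` (rotate the places, flip any set of signs) is realised by an automorphism of `ℂ`

Cell `pub-hodgecm2` (COR-CM), binder seat b25 (gen 37); COUNT-NEUTRAL own lane (W-b of B01-SIZE §4 T2); ONE auxiliary
definition (`frameOf`, the frame attached to a half-system `t : ℤ/3 → Hom(K, ℂ)` of embeddings) and theorems; no named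
fact, no `sorry`.  Discharges the frame hypotheses `he_conj`, `he_gal` of `CorCM/PairFlipSexticFourCoreTransfer.lean` /
`…CodimTwo.lean` from «`[K:ℚ] = 6` and the normal closure `L` of `K` has degree `24` or `48`» — the field class of the
stage-1 statement `PerL` — using p2's PAIR FLIPS (`SexticCMFieldPairFlip.pairFlip_of_finrank_normalClosure`: every
conjugate pair of embeddings is exchanged by an automorphism of `ℂ` fixing the other four) and the transitivity of
`Aut(ℂ)` on `Hom(K, ℂ)` (`Pohlmann1968.isPretransitive_ringEquiv_complex`).

* §1 Frame maps (any CM field `K`, any frame `e` with `e(s̄) = (place, ¬sign)`): realised maps compose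
  (`realised_comp`); EVERY `σ ∈ Aut(ℂ)` acts on the frame as `(p, b) ↦ (π p, b ⊻ δ p)` with `π` injective
  (`exists_perm_twist` — complex conjugation commutes with `Aut(ℂ)` on the embeddings of a CM field).
* §2 `frameOf h6 t ht htc` — the frame `t p ↦ (p, +)`, `(t p)‾ ↦ (p, −)` of a half-system `t` (three pairwise
  non-conjugate embeddings, e.g. a CM type enumerated), with `frameOf_conj` (= `he_conj`).
* §3 For `[L:ℚ] ∈ {24, 48}`: `realised_flip` (the flip of ONE pair, p2), `realised_flipAt` (all eight sign patterns),
  `exists_realised_rotation` (a place rotation `p ↦ p + c`, `c ≠ 0`, with some sign twist: `Aut(ℂ)` moves `t 0` to `t 1`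
  and to `t 2`; the induced injective place maps are rotations or transpositions, and two transpositions compose to a
  rotation — a `decide` on the value table), and **`realised_rotate_flipAt`** = the hypothesis `he_gal`: for every
  `j ∈ ℤ/3` and every sign pattern `fl`, some `σ ∈ Aut(ℂ)` acts as `(p, b) ↦ (p + j, b ⊻ fl_{p+j})`.
HONEST FRAMING: Galois bookkeeping only; nothing here is a case of the Hodge conjecture; `HC_CM` is not used.
[cite: Dodson1984, §5.1] [cite: Shimura1998, §18.2 Lemma (i)] [cite: Lang2002, VI §1 Thm. 1.14]

## References
* [Dodson1984] B. Dodson, The structure of Galois groups of CM-fields, Trans. AMS 283 (1984), §5.1 (the imprimitive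
  sextic structures of order 24 and 48).  [Shimura1998] G. Shimura, §18.2 Lemma (i).  [Lang2002] S. Lang, Algebra, VI §1.
-/

noncomputable section

open NumberField

namespace Summit.HodgeConjecture.CorCM.PairFlipSexticFourCore

open Literature.AlgebraicGeometry.Pohlmann1968 (conj_smul_eq_conjugate isPretransitive_ringEquiv_complex)
open Literature.NumberTheory.ComplexMultiplication
open Summit.HodgeConjecture.CorCM.NonGaloisField (comp_conjugate)
open Summit.HodgeConjecture.CorCM.Census.PairFlipSexticFourCore (flipAt)


/-! ## §1 Frame maps of an arbitrary frame -/

section FrameMaps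

variable {K : Type} [Field K] [NumberField K] [IsCMField K] {e : (K →+* ℂ) ≃ ZMod 3 × Bool}
  (he_conj : ∀ s : K →+* ℂ, e (ComplexEmbedding.conjugate s) = ((e s).1, !(e s).2))

omit [NumberField K] [IsCMField K] in
/-- Composition of automorphisms composes the realised frame maps. [folklore] -/
theorem realised_comp {m m' : ZMod 3 × Bool → ZMod 3 × Bool}
    (hm : ∃ σ : ℂ ≃+* ℂ, ∀ s : K →+* ℂ, e ((σ : ℂ →+* ℂ).comp s) = m (e s))
    (hm' : ∃ σ : ℂ ≃+* ℂ, ∀ s : K →+* ℂ, e ((σ : ℂ →+* ℂ).comp s) = m' (e s)) :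
    ∃ σ : ℂ ≃+* ℂ, ∀ s : K →+* ℂ, e ((σ : ℂ →+* ℂ).comp s) = m' (m (e s)) := by
  obtain ⟨σ, hσ⟩ := hm
  obtain ⟨σ', hσ'⟩ := hm'
  refine ⟨σ.trans σ', fun s => ?_⟩
  have hc : ((σ.trans σ' : ℂ ≃+* ℂ) : ℂ →+* ℂ).comp s = (σ' : ℂ →+* ℂ).comp ((σ : ℂ →+* ℂ).comp s) :=
    RingHom.ext fun _ => rfl
  rw [hc, hσ', hσ]

omit [NumberField K] [IsCMField K] in
/-- The identity is realised (as the rotation by `0` with no flips). [folklore] -/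
theorem realised_id : ∃ σ : ℂ ≃+* ℂ, ∀ s : K →+* ℂ,
    e ((σ : ℂ →+* ℂ).comp s) = ((e s).1 + 0, xor (e s).2 false) :=
  ⟨RingEquiv.refl ℂ, fun s => by
    rw [add_zero, Bool.xor_false]
    exact congrArg e (RingHom.ext fun _ => rfl)⟩

omit [NumberField K] [IsCMField K] in
/-- Post-composition with an automorphism of `ℂ` is injective on `Hom(K, ℂ)`. [folklore] -/
theorem comp_injective (σ : ℂ ≃+* ℂ) : Function.Injective fun s : K →+* ℂ => (σ : ℂ →+* ℂ).comp s :=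
  fun s s' h => RingHom.ext fun a => σ.injective (by
    have h1 := RingHom.congr_fun h a
    simp only [RingHom.coe_comp, RingHom.coe_coe, Function.comp_apply] at h1
    exact h1)

include he_conj in
/-- **Every `σ ∈ Aut(ℂ)` acts on the frame as `(p, b) ↦ (π p, b ⊻ δ p)` with `π` injective** (the place of `σ ∘ s`
depends only on the place of `s`, and `σ` commutes with the sign flip: `σ ∘ s̄ = (σ ∘ s)‾` for a CM field).
[cite: Shimura1998, §18.2 Lemma (i)] -/
theorem exists_perm_twist (σ : ℂ ≃+* ℂ) : ∃ (π : ZMod 3 → ZMod 3) (δ : ZMod 3 → Bool), Function.Injective π ∧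
    ∀ s : K →+* ℂ, e ((σ : ℂ →+* ℂ).comp s) = (π (e s).1, xor (e s).2 (δ (e s).1)) := by
  set g : ZMod 3 × Bool → ZMod 3 × Bool := fun y => e ((σ : ℂ →+* ℂ).comp (e.symm y)) with hg
  have hginj : Function.Injective g := fun y y' h =>
    e.symm.injective (comp_injective σ (e.injective h))
  have hgnot : ∀ (p : ZMod 3) (b : Bool), g (p, !b) = ((g (p, b)).1, !(g (p, b)).2) := fun p b =>
    frame_comp_symm_not he_conj σ p b
  refine ⟨fun p => (g (p, true)).1, fun p => !(g (p, true)).2, fun p q hpq => ?_, fun s => ?_⟩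
  · -- injectivity of the place map
    change (g (p, true)).1 = (g (q, true)).1 at hpq
    by_cases hs : (g (p, true)).2 = (g (q, true)).2
    · have h : g (p, true) = g (q, true) := Prod.ext hpq hs
      exact congrArg Prod.fst (hginj h)
    · have hs' : (g (p, true)).2 = !(g (q, true)).2 := by
        revert hs; cases (g (p, true)).2 <;> cases (g (q, true)).2 <;> decide
      have h : g (p, true) = g (q, !true) := by
        rw [hgnot]; exact Prod.ext hpq hs'
      exact absurd (congrArg Prod.snd (hginj h)) (by simp)
  · -- the formula, read on `s = e⁻¹ (p, b)`
    have hs : e ((σ : ℂ →+* ℂ).comp s) = g (e s) := by rw [hg]; simp only [Equiv.symm_apply_apply]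
    rw [hs]
    obtain ⟨⟨p, b⟩, hy⟩ : ∃ y, e s = y := ⟨_, rfl⟩
    rw [hy]
    obtain ⟨⟨q, c⟩, hq⟩ : ∃ z, g (p, true) = z := ⟨_, rfl⟩
    have hq' : g (p, false) = (q, !c) := by
      have h := hgnot p true
      rw [hq] at h
      exact h
    cases b
    · rw [hq']; simp only [hq]; cases c <;> rfl
    · simp only [hq]; cases c <;> rfl

end FrameMaps

/-! ## §2 The frame of a half-system of embeddings -/

section FrameOf

variable {K : Type} [Field K] [NumberField K] (h6 : Module.finrank ℚ K = 6)
  (t : ZMod 3 → (K →+* ℂ)) (ht : Function.Injective t) (htc : ∀ p q, t p ≠ ComplexEmbedding.conjugate (t q))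

include h6 ht htc in
/-- `(p, +) ↦ t p`, `(p, −) ↦ (t p)‾` is a bijection `ℤ/3 × Bool → Hom(K, ℂ)` for a half-system `t`. [folklore] -/
theorem bijective_halfSystem :
    Function.Bijective fun y : ZMod 3 × Bool => if y.2 then t y.1 else ComplexEmbedding.conjugate (t y.1) := by
  have hinj : Function.Injective fun y : ZMod 3 × Bool =>
      if y.2 then t y.1 else ComplexEmbedding.conjugate (t y.1) := by
    rintro ⟨p, b⟩ ⟨p', b'⟩ h
    cases b <;> cases b' <;> simp only [Bool.false_eq_true, ↓reduceIte] at h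
    · have := congrArg ComplexEmbedding.conjugate h
      rw [ComplexEmbedding.involutive_conjugate K, ComplexEmbedding.involutive_conjugate K] at this
      rw [ht this]
    · exact absurd h.symm (htc p' p)
    · exact absurd h (htc p p')
    · rw [ht h]
  refine (Fintype.bijective_iff_injective_and_card _).2 ⟨hinj, ?_⟩
  rw [Fintype.card_prod, ZMod.card, Fintype.card_bool, Embeddings.card, h6]

/-- **The frame of the half-system `t`**: the inverse of `(p, +) ↦ t p`, `(p, −) ↦ (t p)‾`. [folklore] -/
def frameOf : (K →+* ℂ) ≃ ZMod 3 × Bool :=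
  (Equiv.ofBijective _ (bijective_halfSystem h6 t ht htc)).symm

/-- `frameOf⁻¹ (p, b)` is `t p` or `(t p)‾`. [folklore] -/
theorem frameOf_symm_apply (y : ZMod 3 × Bool) :
    (frameOf h6 t ht htc).symm y = if y.2 then t y.1 else ComplexEmbedding.conjugate (t y.1) := by
  rw [frameOf, Equiv.symm_symm, Equiv.ofBijective_apply]

/-- `frameOf (t p) = (p, +)`. [folklore] -/
@[simp] theorem frameOf_apply_t (p : ZMod 3) : frameOf h6 t ht htc (t p) = (p, true) := by
  rw [Equiv.apply_eq_iff_eq_symm_apply, frameOf_symm_apply]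
  simp

/-- `frameOf (t p)‾ = (p, −)`. [folklore] -/
@[simp] theorem frameOf_apply_conj_t (p : ZMod 3) :
    frameOf h6 t ht htc (ComplexEmbedding.conjugate (t p)) = (p, false) := by
  rw [Equiv.apply_eq_iff_eq_symm_apply, frameOf_symm_apply]
  simp

/-- **`he_conj` for `frameOf`**: complex conjugation keeps the place and flips the sign. [folklore] -/
theorem frameOf_conj (s : K →+* ℂ) :
    frameOf h6 t ht htc (ComplexEmbedding.conjugate s) =
      ((frameOf h6 t ht htc s).1, !(frameOf h6 t ht htc s).2) := by
  obtain ⟨⟨p, b⟩, hy⟩ : ∃ y, (frameOf h6 t ht htc).symm y = s := ⟨_, Equiv.symm_apply_apply _ s⟩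
  rw [← hy, Equiv.apply_symm_apply, frameOf_symm_apply]
  cases b
  · simp only [Bool.false_eq_true, ↓reduceIte, Bool.not_false]
    rw [ComplexEmbedding.involutive_conjugate K, frameOf_apply_t]
  · simp only [↓reduceIte, frameOf_apply_conj_t, Bool.not_true]

end FrameOf

/-! ## §3 Pair-flip fields: every map of `(ℤ/2)³ ⋊ C₃` is realised -/

section PairFlip

variable {K : Type} [Field K] [NumberField K] [IsCMField K] (h6 : Module.finrank ℚ K = 6)
  (L : Type) [Field L] [NumberField L] [IsNormalClosure ℚ K L]
  (hL : Module.finrank ℚ L = 24 ∨ Module.finrank ℚ L = 48)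
  (t : ZMod 3 → (K →+* ℂ)) (ht : Function.Injective t) (htc : ∀ p q, t p ≠ ComplexEmbedding.conjugate (t q))

include hL in
/-- **The flip of ONE pair is realised** (p2's pair flip at the place `p`): some `σ ∈ Aut(ℂ)` acts on the frame as
`(q, b) ↦ (q, b ⊻ [q = p])`. [cite: Dodson1984, §5.1] -/
theorem realised_flip (p : ZMod 3) : ∃ σ : ℂ ≃+* ℂ, ∀ s : K →+* ℂ,
    frameOf h6 t ht htc ((σ : ℂ →+* ℂ).comp s) =
      ((frameOf h6 t ht htc s).1, xor (frameOf h6 t ht htc s).2 (decide ((frameOf h6 t ht htc s).1 = p))) := by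
  obtain ⟨σ, hσ0, hσ⟩ := GenericCMField.pairFlip_of_finrank_normalClosure h6 L hL (t p)
  have hσ0' : (σ : ℂ →+* ℂ).comp (t p) = ComplexEmbedding.conjugate (t p) := by
    rw [← conj_smul_eq_conjugate]; exact hσ0
  refine ⟨σ, fun s => ?_⟩
  obtain ⟨⟨q, b⟩, hy⟩ : ∃ y, (frameOf h6 t ht htc).symm y = s := ⟨_, Equiv.symm_apply_apply _ s⟩
  rw [← hy, Equiv.apply_symm_apply]
  by_cases hqp : q = p
  · subst hqp
    rw [frameOf_symm_apply]
    cases b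
    · simp only [Bool.false_eq_true, ↓reduceIte, decide_true, Bool.xor_true, Bool.not_false]
      rw [comp_conjugate, hσ0', ComplexEmbedding.involutive_conjugate K, frameOf_apply_t]
    · simp only [↓reduceIte, decide_true, Bool.xor_true, Bool.not_true]
      rw [hσ0', frameOf_apply_conj_t]
  · have hfix : (σ : ℂ →+* ℂ).comp ((frameOf h6 t ht htc).symm (q, b)) = (frameOf h6 t ht htc).symm (q, b) := by
      refine hσ _ (fun h => hqp ?_) (fun h => hqp ?_)
      · have h' := congrArg (frameOf h6 t ht htc) h
        rw [Equiv.apply_symm_apply, frameOf_apply_t] at h'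
        exact congrArg Prod.fst h'
      · rw [conj_smul_eq_conjugate] at h
        have h' := congrArg (frameOf h6 t ht htc) h
        rw [Equiv.apply_symm_apply, frameOf_apply_conj_t] at h'
        exact congrArg Prod.fst h'
    rw [hfix, Equiv.apply_symm_apply, decide_eq_false hqp, Bool.xor_false]

/-- The optional flip of the pair at the place `p` (flip iff `on`), as a map of the frame. [folklore] -/
def optFlip (on : Bool) (p : ZMod 3) : ZMod 3 × Bool → ZMod 3 × Bool := fun z => (z.1, xor z.2 (on && decide (z.1 = p)))

/-- The composite of the three optional flips is the flip pattern `fl` (finite check). [folklore] -/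
theorem flip_composite (fl : Bool × Bool × Bool) (y : ZMod 3 × Bool) :
    optFlip fl.2.2 2 (optFlip fl.2.1 1 (optFlip fl.1 0 y)) = (y.1, xor y.2 (flipAt fl y.1)) := by
  revert fl y
  decide

include hL in
/-- An optional flip is realised. [folklore] -/
theorem realised_optFlip (on : Bool) (p : ZMod 3) : ∃ σ : ℂ ≃+* ℂ, ∀ s : K →+* ℂ,
    frameOf h6 t ht htc ((σ : ℂ →+* ℂ).comp s) = optFlip on p (frameOf h6 t ht htc s) := by
  cases on
  · refine ⟨RingEquiv.refl ℂ, fun s => ?_⟩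
    have h : optFlip false p (frameOf h6 t ht htc s) = frameOf h6 t ht htc s := by
      simp only [optFlip, Bool.false_and, Bool.xor_false, Prod.mk.eta]
    rw [h]
    exact congrArg _ (RingHom.ext fun _ => rfl)
  · obtain ⟨σ, hσ⟩ := realised_flip h6 L hL t ht htc p
    refine ⟨σ, fun s => ?_⟩
    rw [hσ s]
    simp only [optFlip, Bool.true_and]

include hL in
/-- **Every sign pattern is realised**: for `fl : Bool × Bool × Bool` some `σ ∈ Aut(ℂ)` acts as
`(q, b) ↦ (q, b ⊻ fl_q)`. [cite: Dodson1984, §5.1] -/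
theorem realised_flipAt (fl : Bool × Bool × Bool) : ∃ σ : ℂ ≃+* ℂ, ∀ s : K →+* ℂ,
    frameOf h6 t ht htc ((σ : ℂ →+* ℂ).comp s) =
      ((frameOf h6 t ht htc s).1, xor (frameOf h6 t ht htc s).2 (flipAt fl (frameOf h6 t ht htc s).1)) := by
  obtain ⟨σ, hσ⟩ := realised_comp (e := frameOf h6 t ht htc)
    (m := fun y => optFlip fl.2.1 1 (optFlip fl.1 0 y)) (m' := optFlip fl.2.2 2)
    (realised_comp (e := frameOf h6 t ht htc) (m := optFlip fl.1 0) (m' := optFlip fl.2.1 1)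
      (realised_optFlip h6 L hL t ht htc fl.1 0) (realised_optFlip h6 L hL t ht htc fl.2.1 1))
    (realised_optFlip h6 L hL t ht htc fl.2.2 2)
  refine ⟨σ, fun s => ?_⟩
  rw [hσ s]
  exact flip_composite fl _

/-- The three elements of `ℤ/3`. [folklore] -/
theorem zmod3_cases : ∀ x : ZMod 3, x = 0 ∨ x = 1 ∨ x = 2 := by decide

set_option synthInstance.maxSize 4096 in
set_option synthInstance.maxHeartbeats 400000 in
set_option maxHeartbeats 4000000 in
/-- Two injective place maps moving `0` to `1` resp. `2`, read by their values (`aᵢ = π₁ i`, `bᵢ = π₂ i`,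
`cᵢ = π₂ (π₁ i)`): one of them, or the composite, is a non-trivial rotation (finite check). [folklore] -/
theorem rotation_cases (a₁ a₂ b₁ b₂ c₁ c₂ : ZMod 3) (ha₁ : a₁ ≠ 1) (ha₂ : a₂ ≠ 1) (ha : a₁ ≠ a₂)
    (hb₁ : b₁ ≠ 2) (hb₂ : b₂ ≠ 2) (hb : b₁ ≠ b₂)
    (hc₁ : (a₁ = 0 → c₁ = 2) ∧ (a₁ = 1 → c₁ = b₁) ∧ (a₁ = 2 → c₁ = b₂))
    (hc₂ : (a₂ = 0 → c₂ = 2) ∧ (a₂ = 1 → c₂ = b₁) ∧ (a₂ = 2 → c₂ = b₂)) :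
    (a₁ = 2 ∧ a₂ = 0) ∨ (b₁ = 0 ∧ b₂ = 1) ∨ (b₁ = 1 ∧ c₁ = 2 ∧ c₂ = 0) := by
  revert hc₂; revert hc₁; revert hb; revert hb₂; revert hb₁; revert ha; revert ha₂; revert ha₁
  revert c₂; revert c₁; revert b₂; revert b₁; revert a₂; revert a₁
  decide

include htc in
/-- **A non-trivial place rotation is realised** (with some sign twist): `Aut(ℂ)` is transitive on `Hom(K, ℂ)`, the
induced place maps are injective (`exists_perm_twist`), and an injective self-map of `ℤ/3` moving `0` is a rotation or a
transposition; if both automorphisms moving `t 0` to `t 1`, `t 2` give transpositions, their composite is a rotation.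
[cite: Lang2002, VI §1 Thm. 1.14] -/
theorem exists_realised_rotation : ∃ (c : ZMod 3) (δ : ZMod 3 → Bool), c ≠ 0 ∧ ∃ σ : ℂ ≃+* ℂ, ∀ s : K →+* ℂ,
    frameOf h6 t ht htc ((σ : ℂ →+* ℂ).comp s) =
      ((frameOf h6 t ht htc s).1 + c, xor (frameOf h6 t ht htc s).2 (δ (frameOf h6 t ht htc s).1)) := by
  have he_conj : ∀ s : K →+* ℂ, frameOf h6 t ht htc (ComplexEmbedding.conjugate s) =
      ((frameOf h6 t ht htc s).1, !(frameOf h6 t ht htc s).2) := frameOf_conj h6 t ht htc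
  haveI := isPretransitive_ringEquiv_complex (K := K)
  obtain ⟨σ₁, hσ₁⟩ := MulAction.exists_smul_eq (ℂ ≃+* ℂ) (t 0) (t 1)
  obtain ⟨σ₂, hσ₂⟩ := MulAction.exists_smul_eq (ℂ ≃+* ℂ) (t 0) (t 2)
  have hσ₁' : (σ₁ : ℂ →+* ℂ).comp (t 0) = t 1 := hσ₁
  have hσ₂' : (σ₂ : ℂ →+* ℂ).comp (t 0) = t 2 := hσ₂
  obtain ⟨π₁, δ₁, hinj₁, h₁⟩ := exists_perm_twist he_conj σ₁
  obtain ⟨π₂, δ₂, hinj₂, h₂⟩ := exists_perm_twist he_conj σ₂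
  -- values at the place `0`
  have hπ₁0 : π₁ 0 = 1 := by
    have h := h₁ (t 0); rw [hσ₁', frameOf_apply_t, frameOf_apply_t] at h
    exact (congrArg Prod.fst h).symm
  have hπ₂0 : π₂ 0 = 2 := by
    have h := h₂ (t 0); rw [hσ₂', frameOf_apply_t, frameOf_apply_t] at h
    exact (congrArg Prod.fst h).symm
  have h12 : (1 : ZMod 3) + 1 = 2 := by decide
  have h21 : (2 : ZMod 3) + 1 = 0 := by decide
  have h22 : (2 : ZMod 3) + 2 = 1 := by decide
  have h122 : (1 : ZMod 3) + 2 = 0 := by decide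
  have hcases := rotation_cases (π₁ 1) (π₁ 2) (π₂ 1) (π₂ 2) (π₂ (π₁ 1)) (π₂ (π₁ 2))
    (fun h => absurd (hinj₁ (h.trans hπ₁0.symm)) (by decide))
    (fun h => absurd (hinj₁ (h.trans hπ₁0.symm)) (by decide))
    (fun h => absurd (hinj₁ h) (by decide))
    (fun h => absurd (hinj₂ (h.trans hπ₂0.symm)) (by decide))
    (fun h => absurd (hinj₂ (h.trans hπ₂0.symm)) (by decide))
    (fun h => absurd (hinj₂ h) (by decide))
    ⟨fun h => by rw [h]; exact hπ₂0, fun h => by rw [h], fun h => by rw [h]⟩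
    ⟨fun h => by rw [h]; exact hπ₂0, fun h => by rw [h], fun h => by rw [h]⟩
  rcases hcases with ⟨ha₁, ha₂⟩ | ⟨hb₁, hb₂⟩ | ⟨hb₁, hc₁, hc₂⟩
  · -- `π₁` is the rotation by `1`
    refine ⟨1, δ₁, by decide, σ₁, fun s => ?_⟩
    rw [h₁ s]
    have hrot : ∀ x, π₁ x = x + 1 := fun x => by
      rcases zmod3_cases x with rfl | rfl | rfl
      · rw [zero_add]; exact hπ₁0
      · rw [h12]; exact ha₁
      · rw [h21]; exact ha₂
    rw [hrot]
  · -- `π₂` is the rotation by `2`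
    refine ⟨2, δ₂, by decide, σ₂, fun s => ?_⟩
    rw [h₂ s]
    have hrot : ∀ x, π₂ x = x + 2 := fun x => by
      rcases zmod3_cases x with rfl | rfl | rfl
      · rw [zero_add]; exact hπ₂0
      · rw [h122]; exact hb₁
      · rw [h22]; exact hb₂
    rw [hrot]
  · -- both are transpositions: `σ₂ ∘ σ₁` rotates by `1`
    obtain ⟨σ, hσ⟩ := realised_comp (e := frameOf h6 t ht htc) (m := fun y => (π₁ y.1, xor y.2 (δ₁ y.1)))
      (m' := fun y => (π₂ y.1, xor y.2 (δ₂ y.1))) ⟨σ₁, h₁⟩ ⟨σ₂, h₂⟩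
    refine ⟨1, fun x => xor (δ₁ x) (δ₂ (π₁ x)), by decide, σ, fun s => ?_⟩
    rw [hσ s]
    have hrot : ∀ x, π₂ (π₁ x) = x + 1 := fun x => by
      rcases zmod3_cases x with rfl | rfl | rfl
      · rw [zero_add, hπ₁0]; exact hb₁
      · rw [h12]; exact hc₁
      · rw [h21]; exact hc₂
    change (π₂ (π₁ (frameOf h6 t ht htc s).1), xor (xor (frameOf h6 t ht htc s).2 (δ₁ (frameOf h6 t ht htc s).1))
      (δ₂ (π₁ (frameOf h6 t ht htc s).1))) = _
    rw [hrot, Bool.xor_assoc]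

include hL htc in
/-- From ONE realised rotation `(p, b) ↦ (p + c, b ⊻ δ p)` and all sign patterns, every sign pattern over the rotation
by `c` is realised. [folklore] -/
theorem realised_rotate_flipAt_of_rotation {c : ZMod 3} {δ : ZMod 3 → Bool}
    (hr : ∃ σ : ℂ ≃+* ℂ, ∀ s : K →+* ℂ, frameOf h6 t ht htc ((σ : ℂ →+* ℂ).comp s) =
      ((frameOf h6 t ht htc s).1 + c, xor (frameOf h6 t ht htc s).2 (δ (frameOf h6 t ht htc s).1)))
    (fl : Bool × Bool × Bool) :
    ∃ σ : ℂ ≃+* ℂ, ∀ s : K →+* ℂ, frameOf h6 t ht htc ((σ : ℂ →+* ℂ).comp s) =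
      ((frameOf h6 t ht htc s).1 + c, xor (frameOf h6 t ht htc s).2 (flipAt fl ((frameOf h6 t ht htc s).1 + c))) := by
  -- the correcting sign pattern `fl''_q = fl_q ⊻ δ (q - c)`
  set fl'' : Bool × Bool × Bool :=
    (xor (flipAt fl 0) (δ (0 - c)), xor (flipAt fl 1) (δ (1 - c)), xor (flipAt fl 2) (δ (2 - c))) with hfl''
  have hcorr : ∀ q, flipAt fl'' q = xor (flipAt fl q) (δ (q - c)) := by
    intro q; rcases zmod3_cases q with rfl | rfl | rfl <;> rfl
  obtain ⟨σ, hσ⟩ := realised_comp (e := frameOf h6 t ht htc) (m := fun y => (y.1 + c, xor y.2 (δ y.1)))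
    (m' := fun y => (y.1, xor y.2 (flipAt fl'' y.1))) hr (realised_flipAt h6 L hL t ht htc fl'')
  refine ⟨σ, fun s => ?_⟩
  rw [hσ s]
  change ((frameOf h6 t ht htc s).1 + c,
      xor (xor (frameOf h6 t ht htc s).2 (δ (frameOf h6 t ht htc s).1)) (flipAt fl'' ((frameOf h6 t ht htc s).1 + c))) = _
  rw [hcorr, add_sub_cancel_right]
  cases (frameOf h6 t ht htc s).2 <;> cases δ (frameOf h6 t ht htc s).1 <;>
    cases flipAt fl ((frameOf h6 t ht htc s).1 + c) <;> rfl

/-- In `ℤ/3` a non-zero element generates: `j ∈ {0, c, c + c}` (finite check). [folklore] -/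
theorem eq_zero_or_eq_or_eq_add (c j : ZMod 3) (hc : c ≠ 0) : j = 0 ∨ j = c ∨ j = c + c := by
  revert c j; decide

include hL htc in
/-- **`he_gal` for pair-flip sextic CM fields**: in the frame of a half-system `t`, for every rotation `j ∈ ℤ/3` of the
places and every sign pattern `fl`, some automorphism of `ℂ` acts as `(p, b) ↦ (p + j, b ⊻ fl_{p+j})` — all 24 maps
of `(ℤ/2)³ ⋊ C₃` are realised. [cite: Dodson1984, §5.1] [cite: Lang2002, VI §1 Thm. 1.14] -/
theorem realised_rotate_flipAt (j : ZMod 3) (fl : Bool × Bool × Bool) :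
    ∃ σ : ℂ ≃+* ℂ, ∀ s : K →+* ℂ, frameOf h6 t ht htc ((σ : ℂ →+* ℂ).comp s) =
      ((frameOf h6 t ht htc s).1 + j, xor (frameOf h6 t ht htc s).2 (flipAt fl ((frameOf h6 t ht htc s).1 + j))) := by
  obtain ⟨c, δ, hc, hr⟩ := exists_realised_rotation h6 t ht htc
  rcases eq_zero_or_eq_or_eq_add c j hc with rfl | rfl | rfl
  · exact realised_rotate_flipAt_of_rotation h6 L hL t ht htc (δ := fun _ => false) (realised_id (e := frameOf h6 t ht htc)) fl
  · exact realised_rotate_flipAt_of_rotation h6 L hL t ht htc hr fl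
  · -- rotation by `c + c`: compose the rotation with itself
    have hrr := realised_comp (e := frameOf h6 t ht htc) (m := fun y => (y.1 + c, xor y.2 (δ y.1)))
      (m' := fun y => (y.1 + c, xor y.2 (δ y.1))) hr hr
    refine realised_rotate_flipAt_of_rotation h6 L hL t ht htc (δ := fun x => xor (δ x) (δ (x + c))) ?_ fl
    obtain ⟨σ, hσ⟩ := hrr
    refine ⟨σ, fun s => ?_⟩
    rw [hσ s]
    change ((frameOf h6 t ht htc s).1 + c + c, xor (xor (frameOf h6 t ht htc s).2 (δ (frameOf h6 t ht htc s).1))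
      (δ ((frameOf h6 t ht htc s).1 + c))) = _
    rw [add_assoc, Bool.xor_assoc]

end PairFlip

end Summit.HodgeConjecture.CorCM.PairFlipSexticFourCore

end
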